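import Mathlib
import Literature.Computability.AlgebraicComplexity.ArithCircuitProofs
import HarnessLib

/-!
# Linear-size circuits I: slots, unfolding counts and the useful sub-DAG (definitions)

Route `BarrierLever`, crux `DefinableEquations` (stmt-ValiantsHypothesis-8745), line `registered`,
lead c3.  Vocabulary for the structure theorem behind the FIRST RUNG (`b ≤ 1`) of the crux —
"a polynomial of fan-in-two complexity `≤ n` in `n` variables has a variable of individual degree
`≤ 2`" (`exists_degreeOf_le_two_of_complexity_le`, file `…LinearSizeDegree.lean`) — which with the
monomial equation `∏_j c_{x_j^3}` (`rungOne_of_exists_degreeOf_le_two`, landed) gives the inner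
statement of `DefinableEquations` / `SingleSizeEquations` for every `b ≤ 1` with `(q, a) = (0, 1)`.

For a gate list `gs` (the tree's `ArithCircuit` model: weighted-sum and product gates over operands
`var x` / `const c` / `gate j`, junk references allowed) this file defines
* slot counts `refCnt g j` (operand slots of `g` referencing gate `j`) and `varCnt g x` (slots
  holding the variable `x`), and `gateAt gs i` (list access with an empty gate as junk value);
* `N gs i j`, the number of nodes labelled by gate `j` in the formula obtained by UNFOLDING gate `i`
  (references to gates `≥ i` unfold to nothing, matching the junk value `0` of the semantics), and
  `Lf gs x i`, the number of leaves of that formula labelled by the variable `x`;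
* the useful sub-DAG of an output gate `o`: `useful gs o = {j ≤ o | N gs o j ≠ 0}`, the reference
  multiplicities `ref gs o j = Σ_{i useful, i > j} refCnt (gs i) j` and the occurrence counts
  `occ gs o x = Σ_{i useful} varCnt (gs i) x`;
and proves the bookkeeping identities: the slot count `Σ_x varCnt g x + Σ_{j<m} refCnt g j ≤
fanIn g`, "leaves through nodes" `Lf gs x i = Σ_j N gs i j · varCnt (gs j) x`, "nodes through
parents" `N gs i j = Σ_{i' ∈ (j,i]} N gs i i' · refCnt (gs i') j`, and the formal bound
`Lf gs x i ≤ 2^(i+1)` for fan-in-two lists (registered milestone `leafCount_le_two_pow`).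
-/

set_option linter.dupNamespace false

noncomputable section

namespace Summit.ValiantsHypothesis.ValiantsHypothesis.Theorems.BarrierLeverDefinableEquations

namespace LinearSize

open Literature.Computability.AlgebraicComplexity ArithCircuit MvPolynomial
open scoped BigOperators

/-! ## §1 Counting operand slots -/

section Slots

variable {k : Type} {σ : Type}

/-- `opIsRef j u`: the operand `u` is a reference to gate number `j`. [folklore] -/
def opIsRef (j : ℕ) : Operand k σ → Bool
  | .gate j' => j' == j
  | _ => false

/-- Number of operand slots of the gate `g` referencing gate number `j`. [folklore] -/
def refCnt (g : Gate k σ) (j : ℕ) : ℕ :=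
  g.args.countP (opIsRef j)

/-- The gate at position `i` of a gate list, with the empty sum gate (no operands) as the junk
value out of range. [folklore] -/
def gateAt (gs : List (Gate k σ)) (i : ℕ) : Gate k σ :=
  gs.getD i (.sum [])

/-- In range, `gateAt` is list access. [folklore] -/
theorem gateAt_eq_getElem (gs : List (Gate k σ)) {i : ℕ} (h : i < gs.length) :
    gateAt gs i = gs[i] := by
  simp [gateAt, List.getD_eq_getElem?_getD, h]

/-- In range, `gateAt` of a left summand of an append is `gateAt` of that summand. [folklore] -/
theorem gateAt_append_left (gs gs' : List (Gate k σ)) {i : ℕ} (h : i < gs.length) :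
    gateAt (gs ++ gs') i = gateAt gs i := by
  simp [gateAt, List.getD_eq_getElem?_getD, List.getElem?_append_left h]

/-- The appended gate sits at position `gs.length`. [folklore] -/
theorem gateAt_append_length (gs : List (Gate k σ)) (g : Gate k σ) :
    gateAt (gs ++ [g]) gs.length = g := by
  simp [gateAt, List.getD_eq_getElem?_getD]

/-- In range, `gateAt` is a member of the list. [folklore] -/
theorem gateAt_mem (gs : List (Gate k σ)) {i : ℕ} (h : i < gs.length) : gateAt gs i ∈ gs := by
  rw [gateAt_eq_getElem gs h]; exact List.getElem_mem h

variable [DecidableEq σ]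

/-- `opIsVar x u`: the operand `u` is the input variable `x`. [folklore] -/
def opIsVar (x : σ) : Operand k σ → Bool
  | .var y => decide (y = x)
  | _ => false

/-- Number of operand slots of the gate `g` holding the variable `x`. [folklore] -/
def varCnt (g : Gate k σ) (x : σ) : ℕ :=
  g.args.countP (opIsVar x)

/-- **Slot count.** The variable slots and the gate-reference slots below `m` of a list of
operands are at most all its slots: `Σ_x #{x-slots} + Σ_{j<m} #{slots → j} ≤ length`.
[folklore] -/
theorem sum_countP_isVar_add_sum_countP_isRef_le [Fintype σ] (us : List (Operand k σ)) (m : ℕ) :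
    ∑ x, us.countP (opIsVar x) + ∑ j ∈ Finset.range m, us.countP (opIsRef j)
      ≤ us.length := by
  induction us with
  | nil => simp
  | cons u us ih =>
    simp only [List.countP_cons, Finset.sum_add_distrib, List.length_cons]
    have hu : ∑ x, (if (opIsVar x u) = true then 1 else 0) +
        ∑ j ∈ Finset.range m, (if (opIsRef j u) = true then 1 else 0) ≤ 1 := by
      cases u with
      | var y => simp [opIsVar, opIsRef, Finset.sum_ite_eq]
      | const c => simp [opIsVar, opIsRef]
      | gate j =>
        simp only [opIsVar, opIsRef, beq_iff_eq, Finset.sum_ite_eq,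
          Finset.mem_range, Bool.false_eq_true, if_false, Finset.sum_const_zero, zero_add]
        split_ifs <;> simp
    omega

/-- The slots of a fan-in-two gate: `Σ_x varCnt g x + Σ_{j<m} refCnt g j ≤ fanIn g ≤ 2`.
[folklore] -/
theorem sum_varCnt_add_sum_refCnt_le [Fintype σ] (g : Gate k σ) (m : ℕ) :
    ∑ x, varCnt g x + ∑ j ∈ Finset.range m, refCnt g j ≤ g.fanIn :=
  sum_countP_isVar_add_sum_countP_isRef_le g.args m

end Slots

/-! ## §2 Node and leaf counts of the unfolding -/

section Unfolding

variable {k : Type} {σ : Type}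

/-- `N gs i j`: the number of nodes labelled by gate `j` in the formula obtained by unfolding gate
`i` of the gate list `gs` (references to gates `≥ i` — junk — unfold to nothing). [folklore] -/
def N (gs : List (Gate k σ)) : ℕ → ℕ → ℕ
  | i, j => (if j = i then 1 else 0) + ∑ j' : Fin i, refCnt (gateAt gs i) j' * N gs j' j

/-- Unfolding equation of `N` with a `Finset.range` sum. [folklore] -/
theorem N_eq (gs : List (Gate k σ)) (i j : ℕ) :
    N gs i j = (if j = i then 1 else 0) +
      ∑ j' ∈ Finset.range i, refCnt (gateAt gs i) j' * N gs j' j := by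
  rw [N, Fin.sum_univ_eq_sum_range (fun j' => refCnt (gateAt gs i) j' * N gs j' j) i]

/-- A node of the unfolding of gate `i` is labelled by a gate `≤ i`. [folklore] -/
theorem N_eq_zero_of_lt (gs : List (Gate k σ)) {i j : ℕ} (h : i < j) : N gs i j = 0 := by
  induction i using Nat.strong_induction_on with
  | _ i ih =>
    rw [N_eq, if_neg (by omega), zero_add]
    refine Finset.sum_eq_zero fun j' hj' => ?_
    rw [Finset.mem_range] at hj'
    rw [ih j' hj' (by omega), mul_zero]

/-- The root: gate `i` labels exactly one node of its own unfolding. [folklore] -/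
theorem N_self (gs : List (Gate k σ)) (i : ℕ) : N gs i i = 1 := by
  rw [N_eq, if_pos rfl]
  suffices h : ∑ j' ∈ Finset.range i, refCnt (gateAt gs i) j' * N gs j' i = 0 by rw [h]
  refine Finset.sum_eq_zero fun j' hj' => ?_
  rw [Finset.mem_range] at hj'
  rw [N_eq_zero_of_lt gs hj', mul_zero]

/-- Below the root, `N` is the sum over the reference slots of the root. [folklore] -/
theorem N_of_lt (gs : List (Gate k σ)) {i j : ℕ} (h : j < i) :
    N gs i j = ∑ j' ∈ Finset.range i, refCnt (gateAt gs i) j' * N gs j' j := by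
  rw [N_eq, if_neg (by omega), zero_add]

/-- `N` at index `i` only depends on the gates `≤ i`. [folklore] -/
theorem N_append_left (gs gs' : List (Gate k σ)) {i : ℕ} (h : i < gs.length) (j : ℕ) :
    N (gs ++ gs') i j = N gs i j := by
  induction i using Nat.strong_induction_on generalizing j with
  | _ i ih =>
    rw [N_eq, N_eq, gateAt_append_left gs gs' h]
    congr 1
    refine Finset.sum_congr rfl fun j' hj' => ?_
    rw [Finset.mem_range] at hj'
    rw [ih j' hj' (by omega)]

/-- **Nodes through parents**: for `j < i`, every `j`-node of the unfolding of gate `i` hangs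
on a reference slot of its parent node, `N gs i j = Σ_{i' ∈ (j, i]} N gs i i' · refCnt (gs i') j`.
[folklore] -/
theorem N_eq_sum_parent (gs : List (Gate k σ)) {i j : ℕ} (h : j < i) :
    N gs i j = ∑ i' ∈ Finset.Ioc j i, N gs i i' * refCnt (gateAt gs i') j := by
  induction i using Nat.strong_induction_on with
  | _ i ih =>
    -- split off the parent i' = i on the right
    rw [← Finset.Ioo_insert_right h, Finset.sum_insert (by simp), N_self, one_mul, N_of_lt gs h]
    -- on the left, split the slot sum at j' = j; slots j' < j contribute nothing
    have hj : j ∈ Finset.range i := Finset.mem_range.2 h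
    rw [← Finset.add_sum_erase _ _ hj, N_self, mul_one]
    congr 1
    have hset : ∀ j' ∈ (Finset.range i).erase j, j' ∉ Finset.Ioo j i →
        refCnt (gateAt gs i) j' * N gs j' j = 0 := by
      intro j' hj' hj''
      rw [Finset.mem_erase, Finset.mem_range] at hj'
      rw [Finset.mem_Ioo, not_and'] at hj''
      have : j' < j := by
        rcases Nat.lt_or_ge j' j with h' | h'
        · exact h'
        · exact absurd (lt_of_le_of_ne h' (Ne.symm hj'.1)) (hj'' hj'.2)
      rw [N_eq_zero_of_lt gs this, mul_zero]
    have hsub : Finset.Ioo j i ⊆ (Finset.range i).erase j := by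
      intro j' hj'
      rw [Finset.mem_Ioo] at hj'
      exact Finset.mem_erase.2 ⟨by omega, Finset.mem_range.2 hj'.2⟩
    rw [← Finset.sum_subset hsub hset]
    -- now both sides range over (j, i)
    calc ∑ j' ∈ Finset.Ioo j i, refCnt (gateAt gs i) j' * N gs j' j
        = ∑ j' ∈ Finset.Ioo j i, ∑ i' ∈ Finset.Ioo j i,
            refCnt (gateAt gs i) j' * (N gs j' i' * refCnt (gateAt gs i') j) := by
          refine Finset.sum_congr rfl fun j' hj' => ?_
          rw [Finset.mem_Ioo] at hj'
          rw [ih j' hj'.2 hj'.1, Finset.mul_sum]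
          have hsub' : Finset.Ioc j j' ⊆ Finset.Ioo j i := by
            intro i' hi'
            rw [Finset.mem_Ioc] at hi'
            exact Finset.mem_Ioo.2 ⟨hi'.1, by omega⟩
          refine Finset.sum_subset hsub' fun i' hi' hi'' => ?_
          rw [Finset.mem_Ioo] at hi'
          rw [Finset.mem_Ioc, not_and'] at hi''
          have : j' < i' := by
            rcases Nat.lt_or_ge j' i' with h' | h'
            · exact h'
            · exact absurd hi'.1 (hi'' h')
          rw [N_eq_zero_of_lt gs this, zero_mul, mul_zero]
      _ = ∑ i' ∈ Finset.Ioo j i, (∑ j' ∈ Finset.Ioo j i,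
            refCnt (gateAt gs i) j' * N gs j' i') * refCnt (gateAt gs i') j := by
          rw [Finset.sum_comm]
          refine Finset.sum_congr rfl fun i' _ => ?_
          rw [Finset.sum_mul]
          refine Finset.sum_congr rfl fun j' _ => ?_
          ring
      _ = ∑ i' ∈ Finset.Ioo j i, N gs i i' * refCnt (gateAt gs i') j := by
          refine Finset.sum_congr rfl fun i' hi' => ?_
          rw [Finset.mem_Ioo] at hi'
          rw [N_of_lt gs hi'.2]
          congr 1
          have hsub' : Finset.Ioo j i ⊆ Finset.range i := by
            intro j' hj'
            rw [Finset.mem_Ioo] at hj'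
            exact Finset.mem_range.2 hj'.2
          refine Finset.sum_subset hsub' fun j' hj' hj'' => ?_
          rw [Finset.mem_range] at hj'
          rw [Finset.mem_Ioo, not_and] at hj''
          by_cases h' : j < j'
          · exact absurd hj' (hj'' h')
          · rw [N_eq_zero_of_lt gs (show j' < i' by omega), mul_zero]

variable [DecidableEq σ]

/-- `Lf gs x i`: the number of leaves labelled by the variable `x` in the unfolding of gate `i`.
[folklore] -/
def Lf (gs : List (Gate k σ)) (x : σ) : ℕ → ℕ
  | i => varCnt (gateAt gs i) x + ∑ j' : Fin i, refCnt (gateAt gs i) j' * Lf gs x j'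

/-- Unfolding equation of `Lf` with a `Finset.range` sum. [folklore] -/
theorem Lf_eq (gs : List (Gate k σ)) (x : σ) (i : ℕ) :
    Lf gs x i = varCnt (gateAt gs i) x +
      ∑ j' ∈ Finset.range i, refCnt (gateAt gs i) j' * Lf gs x j' := by
  rw [Lf, Fin.sum_univ_eq_sum_range (fun j' => refCnt (gateAt gs i) j' * Lf gs x j') i]

/-- `Lf` at index `i` only depends on the gates `≤ i`. [folklore] -/
theorem Lf_append_left (gs gs' : List (Gate k σ)) (x : σ) {i : ℕ} (h : i < gs.length) :
    Lf (gs ++ gs') x i = Lf gs x i := by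
  induction i using Nat.strong_induction_on with
  | _ i ih =>
    rw [Lf_eq, Lf_eq, gateAt_append_left gs gs' h]
    congr 1
    refine Finset.sum_congr rfl fun j' hj' => ?_
    rw [Finset.mem_range] at hj'
    rw [ih j' hj' (by omega)]

/-- **Leaves through nodes**: the `x`-leaves of the unfolding of gate `i` are the `x`-slots of
its nodes, `Lf gs x i = Σ_{j ≤ i} N gs i j · varCnt (gs j) x`. [folklore] -/
theorem Lf_eq_sum_N (gs : List (Gate k σ)) (x : σ) (i : ℕ) :
    Lf gs x i = ∑ j ∈ Finset.range (i + 1), N gs i j * varCnt (gateAt gs j) x := by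
  induction i using Nat.strong_induction_on with
  | _ i ih =>
    have hkey : ∑ j' ∈ Finset.range i, refCnt (gateAt gs i) j' * Lf gs x j'
        = ∑ j ∈ Finset.range i, N gs i j * varCnt (gateAt gs j) x := by
      calc ∑ j' ∈ Finset.range i, refCnt (gateAt gs i) j' * Lf gs x j'
          = ∑ j' ∈ Finset.range i, refCnt (gateAt gs i) j' *
              ∑ j ∈ Finset.range i, N gs j' j * varCnt (gateAt gs j) x := by
            refine Finset.sum_congr rfl fun j' hj' => ?_
            rw [Finset.mem_range] at hj'
            have hext : ∑ j ∈ Finset.range (j' + 1), N gs j' j * varCnt (gateAt gs j) x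
                = ∑ j ∈ Finset.range i, N gs j' j * varCnt (gateAt gs j) x := by
              refine Finset.sum_subset (fun j hj => ?_) fun j hj hj'' => ?_
              · rw [Finset.mem_range] at hj ⊢; omega
              rw [Finset.mem_range] at hj hj''
              rw [N_eq_zero_of_lt gs (show j' < j by omega), zero_mul]
            rw [ih j' hj', hext]
        _ = ∑ j ∈ Finset.range i, (∑ j' ∈ Finset.range i,
              refCnt (gateAt gs i) j' * N gs j' j) * varCnt (gateAt gs j) x := by
            simp_rw [Finset.mul_sum, Finset.sum_mul, mul_assoc]
            rw [Finset.sum_comm]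
        _ = ∑ j ∈ Finset.range i, N gs i j * varCnt (gateAt gs j) x := by
            refine Finset.sum_congr rfl fun j hj => ?_
            rw [Finset.mem_range] at hj
            rw [N_of_lt gs hj]
    rw [Lf_eq, Finset.sum_range_succ, N_self, one_mul, hkey, add_comm]

/-- **Formal degree bound**: the unfolding of gate `i` of a fan-in-two gate list has at most
`2^(i+1)` leaves labelled `x`. [folklore] -/
theorem Lf_le_two_pow [Fintype σ] (gs : List (Gate k σ)) (h2 : ∀ g ∈ gs, g.fanIn ≤ 2) (x : σ)
    (i : ℕ) : Lf gs x i ≤ 2 ^ (i + 1) := by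
  induction i using Nat.strong_induction_on with
  | _ i ih =>
    rw [Lf_eq]
    have hfan : (gateAt gs i).fanIn ≤ 2 := by
      by_cases hi : i < gs.length
      · exact h2 _ (gateAt_mem gs hi)
      · simp [gateAt, List.getD_eq_getElem?_getD, List.getElem?_eq_none (Nat.le_of_not_lt hi),
          Gate.fanIn, Gate.args]
    have hslots := sum_varCnt_add_sum_refCnt_le (gateAt gs i) i
    have hvar : varCnt (gateAt gs i) x ≤ ∑ y, varCnt (gateAt gs i) y :=
      Finset.single_le_sum (fun _ _ => Nat.zero_le _) (Finset.mem_univ x)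
    have hrec : ∑ j' ∈ Finset.range i, refCnt (gateAt gs i) j' * Lf gs x j'
        ≤ (∑ j' ∈ Finset.range i, refCnt (gateAt gs i) j') * 2 ^ i := by
      rw [Finset.sum_mul]
      refine Finset.sum_le_sum fun j' hj' => ?_
      rw [Finset.mem_range] at hj'
      refine Nat.mul_le_mul_left _ ((ih j' hj').trans ?_)
      exact Nat.pow_le_pow_right (by norm_num) hj'
    have h1 : 1 ≤ 2 ^ i := Nat.one_le_two_pow
    calc varCnt (gateAt gs i) x + ∑ j' ∈ Finset.range i, refCnt (gateAt gs i) j' * Lf gs x j'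
        ≤ (∑ y, varCnt (gateAt gs i) y) * 2 ^ i +
            (∑ j' ∈ Finset.range i, refCnt (gateAt gs i) j') * 2 ^ i :=
          add_le_add (hvar.trans (Nat.le_mul_of_pos_right _ (by omega))) hrec
      _ = (∑ y, varCnt (gateAt gs i) y + ∑ j' ∈ Finset.range i, refCnt (gateAt gs i) j') *
            2 ^ i := by ring
      _ ≤ 2 * 2 ^ i := Nat.mul_le_mul_right _ (hslots.trans hfan)
      _ = 2 ^ (i + 1) := by ring

end Unfolding

/-! ## §3 The useful sub-DAG of an output gate (definitions) -/

section Useful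

variable {k : Type} {σ : Type}

/-- The useful gates of the output gate `o`: those labelling a node of the unfolding of `o`
(the backward closure of `o` under real references). [folklore] -/
def useful (gs : List (Gate k σ)) (o : ℕ) : Finset ℕ :=
  (Finset.range (o + 1)).filter fun j => N gs o j ≠ 0

/-- Membership in the useful set. [folklore] -/
theorem mem_useful {gs : List (Gate k σ)} {o j : ℕ} :
    j ∈ useful gs o ↔ j ≤ o ∧ N gs o j ≠ 0 := by
  simp [useful, Finset.mem_filter, Finset.mem_range]

/-- The output gate is useful. [folklore] -/
theorem self_mem_useful (gs : List (Gate k σ)) (o : ℕ) : o ∈ useful gs o :=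
  mem_useful.2 ⟨le_rfl, by rw [N_self]; exact one_ne_zero⟩

/-- Outside the useful set the node count vanishes. [folklore] -/
theorem N_eq_zero_of_not_mem_useful {gs : List (Gate k σ)} {o j : ℕ} (h : j ∉ useful gs o) :
    N gs o j = 0 := by
  by_contra h'
  rcases Nat.lt_or_ge o j with hj | hj
  · exact h' (N_eq_zero_of_lt gs hj)
  · exact h (mem_useful.2 ⟨hj, h'⟩)

/-- `ref gs o j`: the number of operand slots of useful gates above `j` that reference gate `j`
(junk references from below are not counted). [folklore] -/
def ref (gs : List (Gate k σ)) (o j : ℕ) : ℕ :=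
  ∑ i ∈ (useful gs o).filter (fun i => j < i), refCnt (gateAt gs i) j

variable [DecidableEq σ]

/-- `occ gs o x`: the number of operand slots of useful gates holding the variable `x`.
[folklore] -/
def occ (gs : List (Gate k σ)) (o : ℕ) (x : σ) : ℕ :=
  ∑ i ∈ useful gs o, varCnt (gateAt gs i) x

end Useful

end LinearSize

open Literature.Computability.AlgebraicComplexity ArithCircuit LinearSize in
/-- **Registered milestone `leafCount_le_two_pow`** (crux stmt-ValiantsHypothesis-8745, line
`registered`, lead c3): in a fan-in-two gate list, the unfolding of gate `i` has at most `2^(i+1)`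
leaves labelled by any one variable (the formal individual degree of a size-`s` circuit is `≤ 2^s`).
[folklore] -/
theorem leafCount_le_two_pow :
    ∀ (n : ℕ) (gs : List (Literature.Computability.AlgebraicComplexity.ArithCircuit.Gate ℂ (Fin n))),
      (∀ g ∈ gs, g.fanIn ≤ 2) → ∀ (x : Fin n) (i : ℕ),
        Summit.ValiantsHypothesis.ValiantsHypothesis.Theorems.BarrierLeverDefinableEquations.LinearSize.Lf gs x i ≤ 2 ^ (i + 1) :=
  fun _ gs h2 x i => Lf_le_two_pow gs h2 x i

end Summit.ValiantsHypothesis.ValiantsHypothesis.Theorems.BarrierLeverDefinableEquations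

end
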